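import Summits.ValiantsHypothesis.ValiantsHypothesis.Theorems.LacunarySymmetroidMatrixDescartesCensusGram

/-!
# `MatrixDescartes` census — the CROSS Gram-rank identity (kernel anchor of the «rank rows»)

HONEST FRAMING.  Object-search cell `pub-symmetroid`, crux `Theses.LacunarySymmetroid.MatrixDescartes`
(stmt-ValiantsHypothesis-18050).  A folklore polynomial identity, companion of `Census.gram_det_four_eq_zero` (the
PRINCIPAL case): for ANY eight real `2 × 2` matrices `S 0 … S 3`, `T 0 … T 3`, the `4 × 4` matrix of polarised determinant
forms `B(S i, T j) = S i 0 0 · T j 1 1 + S i 1 1 · T j 0 0 − 2 · S i 0 1 · T j 0 1` is singular — the bilinear form `B`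
factors through the `3`-dimensional space `Sym₂(ℝ)` (entries `·00, ·01, ·11`), so every `4 × 4` matrix `(B(S i, T j))` has rank
`≤ 3`.  This is the algebraic content of the NON-PRINCIPAL «rank rows» of the post-freeze (R)-row programme (theory g17's
GRAM-RANK NOTE; engine-4 g13 TUBE-E4G13.md §12): on a six-letter pencil the `6 × 6` would-be-Gram matrix `Π` (with
`Π_ll = det S_l`, `Π_lm = B(S_l, S_m)/2`) has every `4 × 4` minor — principal or not — equal to zero.  Nothing here is a
certificate by itself; nothing bears on `ζ_sym(2,6)`, on the crux, or on `VP ≠ VNP`.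

[folklore] Elementary algebra (`ring`).
-/

-- `Summit.ValiantsHypothesis.ValiantsHypothesis.…` repeats a component by the D-0017 layout
-- (single-conjunct summit), which the `dupNamespace` linter flags; the name is mandated.
set_option linter.dupNamespace false

namespace Summit.ValiantsHypothesis.ValiantsHypothesis.Theorems.LacunarySymmetroidMatrixDescartes.Census

open scoped BigOperators Matrix

set_option maxHeartbeats 4000000 in
/-- **Cross Gram-rank identity.**  For any `S T : Fin 4 → Matrix (Fin 2) (Fin 2) ℝ` the `4 × 4` matrix
`(B(S i, T j))_{i,j}` of polarised determinant forms has determinant `0` (rank of `B` through `Sym₂(ℝ)` is at most `3`).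
With `T = S` this is `gram_det_four_eq_zero`. [folklore] -/
theorem gram_det_cross_four_eq_zero (S T : Fin 4 → Matrix (Fin 2) (Fin 2) ℝ) :
    (Matrix.of fun i j : Fin 4 =>
        S i 0 0 * T j 1 1 + S i 1 1 * T j 0 0 - 2 * (S i 0 1 * T j 0 1)).det = 0 := by
  rw [det_fin_four]
  simp only [Matrix.of_apply]
  ring

/-- The same for the HALVED pairing `Π_lm = B(S_l, T_m)/2` used as the would-be-Gram entry (`Π = Gram` of the letters for
the Lorentz form `⟨A, B⟩ = B(A,B)/2` on `Sym₂(ℝ) ≅ ℝ^{1,2}`): any `4 × 4` block of `Π` with four row letters and four column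
letters is singular. [folklore] -/
theorem wouldBeGram_minor_four_eq_zero (S T : Fin 4 → Matrix (Fin 2) (Fin 2) ℝ) :
    (Matrix.of fun i j : Fin 4 =>
        (S i 0 0 * T j 1 1 + S i 1 1 * T j 0 0 - 2 * (S i 0 1 * T j 0 1)) / 2).det = 0 := by
  rw [det_fin_four]
  simp only [Matrix.of_apply]
  ring

end Summit.ValiantsHypothesis.ValiantsHypothesis.Theorems.LacunarySymmetroidMatrixDescartes.Census
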